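import Summits.Schanuel.Schanuel.Theorems.ZilberEacCylinderCriterion
import HarnessLib

/-!
# Arbitrary base branches, CV: CURVES OVER `ℚ̄` WITH A VERTICAL ASYMPTOTE — the complete verdict
# by the index swap (O91, first step)

HONEST FRAMING.  Cell `pub-schanuel` (Zilber's Exponential-Algebraic Closedness, case ladder;
host summit Schanuel), seat 2, gen 33.  File CIV: over every `ℚ̄`-curve of `x₁`-degree `≥ 2`
with a HORIZONTAL asymptote (and irreducible transpose) every surface of Mantova–Masser's case is
dense.  The problem is symmetric under the simultaneous swap `x₀ ↔ x₁`, `y₀ ↔ y₁` (file XCVIII: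
`indexSwapped`), which turns a VERTICAL asymptote `x₀ → θ` (`x₁ → ∞`) into a horizontal one:
**`unprojectedDense_of_mmCase_topRowRoot_algebraic_swap`** — `F ∈ ℚ̄[x₀][x₁]` irreducible whose
transpose `Ft` is irreducible of degree `≥ 2` with a root of ITS top row: every surface of the
case over `{F = 0}` is dense; e.g. EVERY surface over the graph `x₀² + x₀x₁ + x₁ = 0`
(`x₁ = -x₀²/(x₀+1)`, vertical asymptote `x₀ → -1`): **`unprojectedDense_of_mmCase_conicEt_all`**.
What this is NOT: curves with neither a horizontal nor a vertical asymptote (Fermat cubic,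
`x₁² = x₀³ + 1`) — OPEN for non-cylinders; transcendental coefficients; Fib(3,2); EC(3,2) — OPEN;
the question OPEN in general; NOT Schanuel's conjecture (neither used nor implied); EAC ⇏ SC.
-/

noncomputable section

open Filter Topology Set Complex Polynomial
open Literature.NumberTheory.Transcendental Literature.ModelTheory.Zilber
open Literature.ModelTheory.ExponentialFields

set_option linter.dupNamespace false

namespace Summit.Schanuel.Schanuel.Theorems

section HorizontalVerticalAsymptote

variable (F : ℂ[X][X])

/-- **Curves over `ℚ̄` with a vertical asymptote: every surface of the case is dense.**  `F`
irreducible with algebraic coefficients; its transpose `Ft` (`Ft(x, y) = F(y, x)`) irreducible of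
degree `≥ 2` in its main variable with a root of its top row; `Ft₃` = `Ft` inside `ℂ[X₀, X₁, X₂]`
(through its values).  Then every `W` of Mantova–Masser's case with base curve `{F = 0}` has
Zariski-dense exponential points. [cite: MantovaMasser2023, §1 Further remarks, p. 5 (the
question, open in general)] (new) -/
theorem unprojectedDense_of_mmCase_topRowRoot_algebraic_swap (hFirr : Irreducible F)
    (halg : ∀ i j, IsAlgebraic ℚ ((F.coeff j).coeff i)) (Ft : ℂ[X][X])
    (hFt : ∀ x y : ℂ, (Ft.map (Polynomial.evalRingHom x)).eval y =
      (F.map (Polynomial.evalRingHom y)).eval x)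
    (hFtirr : Irreducible Ft) (hnt : 2 ≤ Ft.natDegree) (N : ℕ) (hN : ∀ j, (Ft.coeff j).natDegree ≤ N)
    (T : ℂ[X]) (hT : ∀ j, T.coeff j = (Ft.coeff j).coeff N) (hT0 : T ≠ 0) {θ : ℂ} (hTθ : T.IsRoot θ)
    (Ft₃ : MvPolynomial (Fin 3) ℂ)
    (hFt₃ : ∀ v : Fin 3 → ℂ, MvPolynomial.eval v Ft₃ = (Ft.map (Polynomial.evalRingHom (v 0))).eval (v 1))
    {W : Set (Fin 2 ⊕ Fin 2 → ℂ)} (hmm : MMCaseDimPiOneFree W)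
    (hbase : MvPolynomial.zeroLocus ℂ (MvPolynomial.vanishingIdeal ℂ (projAdd '' (W ∩ torusLocus ℂ 2))) =
      {x : Fin 2 → ℂ | (F.map (Polynomial.evalRingHom (x 0))).eval (x 1) = 0}) :
    UnprojectedDense W := by
  classical
  have hmm' : MMCaseDimPiOneFree (indexSwapped W) := mmCaseDimPiOneFree_indexSwapped hmm
  have hbase' : MvPolynomial.zeroLocus ℂ (MvPolynomial.vanishingIdeal ℂ
      (projAdd '' (indexSwapped W ∩ torusLocus ℂ 2))) =
      {x : Fin 2 → ℂ | (Ft.map (Polynomial.evalRingHom (x 0))).eval (x 1) = 0} := by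
    ext x
    rw [mem_zeroLocus_vanishingIdeal_projAdd_indexSwapped, hbase]
    simp only [Set.mem_setOf_eq, Function.comp_apply, Equiv.swap_apply_left,
      Equiv.swap_apply_right, hFt]
  have h := unprojectedDense_of_mmCase_topRowRoot_algebraic Ft hFtirr hnt N hN T hT hT0 hTθ F
    (fun x y => (hFt y x).symm) hFirr halg Ft₃ hFt₃ hmm' hbase'
  rw [← indexSwapped_indexSwapped W]
  exact unprojectedDense_indexSwapped h

/-- **Every surface of Mantova–Masser's case over the graph `x₀² + x₀x₁ + x₁ = 0`
(`x₁ = -x₀²/(x₀ + 1)`, vertical asymptote `x₀ → -1`) is dense** — the transpose is the conic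
`x₁² + x₀x₁ + x₀` of file CI. [cite: MantovaMasser2023, §1 Further remarks, p. 5 (the question,
open in general)] (new) -/
theorem unprojectedDense_of_mmCase_conicEt_all {W : Set (Fin 2 ⊕ Fin 2 → ℂ)}
    (hmm : MMCaseDimPiOneFree W)
    (hbase : MvPolynomial.zeroLocus ℂ (MvPolynomial.vanishingIdeal ℂ (projAdd '' (W ∩ torusLocus ℂ 2))) =
      {x : Fin 2 → ℂ | x 0 ^ 2 + x 0 * x 1 + x 1 = 0}) :
    UnprojectedDense W := by
  classical
  -- `F = (x₀ + 1)·x₁ + x₀²` (in `x₁` over `ℂ[x₀]`), transpose = the conic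
  set Fg : ℂ[X][X] := Polynomial.C (X + 1 : ℂ[X]) * X + Polynomial.C (X ^ 2 : ℂ[X]) with hFg
  have hFgev : ∀ x y : ℂ, (Fg.map (Polynomial.evalRingHom x)).eval y = (x + 1) * y + x ^ 2 := by
    intro x y; simp [hFg]
  have hc0 : Fg.coeff 0 = X ^ 2 := by
    rw [hFg, Polynomial.coeff_add, Polynomial.coeff_C_mul, Polynomial.coeff_X_zero, mul_zero, zero_add,
      Polynomial.coeff_C_zero]
  have hc1 : Fg.coeff 1 = X + 1 := by
    rw [hFg, Polynomial.coeff_add, Polynomial.coeff_C_mul, Polynomial.coeff_X_one, mul_one,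
      Polynomial.coeff_C, if_neg one_ne_zero, add_zero]
  have hcj : ∀ j, 2 ≤ j → Fg.coeff j = 0 := by
    intro j hj
    rw [hFg, Polynomial.coeff_add, Polynomial.coeff_C_mul, Polynomial.coeff_X, Polynomial.coeff_C,
      if_neg (by omega), if_neg (by omega), mul_zero, add_zero]
  have hFgdeg : Fg.degree = 1 := by
    rw [hFg]; compute_degree!; exact Polynomial.X_add_C_ne_zero 1
  have hFgirr : Irreducible Fg := by
    refine Polynomial.irreducible_of_degree_eq_one_of_isRelPrime_coeff hFgdeg ?_
    rw [hc0, hc1]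
    exact (show IsCoprime (X ^ 2 : ℂ[X]) (X + 1) from ⟨1, 1 - X, by ring⟩).isRelPrime
  have halg : ∀ i j, IsAlgebraic ℚ ((Fg.coeff j).coeff i) := by
    intro i j
    have h01 : (Fg.coeff j).coeff i = 0 ∨ (Fg.coeff j).coeff i = 1 := by
      rcases j with _ | _ | j
      · rw [hc0, Polynomial.coeff_X_pow]; split_ifs <;> simp
      · rw [hc1, Polynomial.coeff_add, Polynomial.coeff_X, Polynomial.coeff_one]
        rcases i with _ | _ | i <;> simp
      · rw [hcj (j + 2) (by omega), Polynomial.coeff_zero]; simp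
    rcases h01 with h | h
    · rw [h]; exact isAlgebraic_zero
    · rw [h]; exact isAlgebraic_one
  have hswap : ∀ x y : ℂ, (((X ^ 2 + Polynomial.C (X : ℂ[X]) * X + Polynomial.C (X : ℂ[X]) :
      ℂ[X][X])).map (Polynomial.evalRingHom x)).eval y = (Fg.map (Polynomial.evalRingHom y)).eval x := by
    intro x y; rw [hFgev, conicE_eval]; ring
  have hF₃ev : ∀ v : Fin 3 → ℂ, MvPolynomial.eval v (MvPolynomial.X 1 ^ 2 +
      MvPolynomial.X 0 * MvPolynomial.X 1 + MvPolynomial.X 0 : MvPolynomial (Fin 3) ℂ) =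
      ((X ^ 2 + Polynomial.C (X : ℂ[X]) * X + Polynomial.C (X : ℂ[X]) : ℂ[X][X]).map
        (Polynomial.evalRingHom (v 0))).eval (v 1) := by
    intro v; rw [conicE_eval]; simp
  refine unprojectedDense_of_mmCase_topRowRoot_algebraic_swap Fg hFgirr halg _ hswap conicE_irreducible
    (by rw [conicE_natDegree]) 1 (fun j => ?_) (X + 1) (fun j => ?_) (Polynomial.X_add_C_ne_zero 1)
    (θ := -1) (by simp) _ hF₃ev hmm (by rw [hbase]; ext x; simp only [Set.mem_setOf_eq, hFgev]; ring_nf)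
  · rw [conicE_coeff]; split_ifs <;> simp
  · rw [conicE_coeff, Polynomial.coeff_add, Polynomial.coeff_X, Polynomial.coeff_one]
    rcases j with _ | _ | _ | j <;> simp [Polynomial.coeff_one]

end HorizontalVerticalAsymptote

end Summit.Schanuel.Schanuel.Theorems
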